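import Summits.BirchSwinnertonDyer.BirchSwinnertonDyer.Theorems.EisensteinPrimesFullDescentKummerArithmetic
import Literature.NumberTheory.EllipticCurves.ZpExtensionEisensteinDVRSettingDualityDataProofs
import Literature.NumberTheory.EllipticCurves.ZpExtensionEisensteinConjugationDatumProofs
import Literature.NumberTheory.Automorphic.GaloisActionPlaces
import Literature.NumberTheory.GaloisRepresentations.IntegralGaloisAction
import Literature.NumberTheory.EllipticCurves.SemistableModPImageAbelianProofs
import HarnessLib

/-!
# Route `TwoAdicConverse` (rung S3), crux `OrdLambdaHalfAtTwo` (item stmt-BirchSwinnertonDyer-19556), line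
# `kato-determinant-greenberg-two`, stub `stub_wbarStepAtTwo` ([C]) — brick T: transport of primes of `\bar ℤ_K` and of their
# decomposition groups along a lift `τ̃` of `σ ∈ Gal(K/ℚ)` (the `w ↔ w̄` swap)

Cell `bsd-2adic`, seat `bsd-2adic-conv-1` GEN 26 (`--supports` stmt-BirchSwinnertonDyer-19556, helper; pen RC-325, (h1) G0 plumbing).
For a number field `K`, `σ ∈ Aut(K/ℚ)` and a ring automorphism `τ̃` of `K̄` lifting `σ` (`IsLiftOfAut σ τ̃`): `τ̃` preserves
`\bar ℤ_K = absIntegers (𝓞 K) K` (`map_mem_absIntegers_of_isLiftOfAut`), so every prime `𝔔` of `\bar ℤ_K` above a place `v`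
has a transported prime `𝔔' = τ̃⁻¹(𝔔)` above `σ⁻¹ • v` whose decomposition group contains `τ̃⁻¹ x τ̃` for every `x ∈ D_𝔔`
(`exists_primesAbove_smul_forall_conjGalCMH_mem` — Neukirch I (9.4) for a semilinear automorphism, stated existentially so that no
definition is introduced).  For `K` imaginary quadratic and `σ ≠ 1`, the places above a rational prime `p` are `w` and `σ • w`
(`eq_or_eq_smul_of_natCast_mem`, transitivity of `Gal(K/ℚ)`; tree `HeightOneSpectrum.exists_algEquiv_smul_eq`).

HONEST FRAMING: theorems only (no definition, no named fact, no `sorry`); Galois bookkeeping; BSD is not proved by any of this.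
PARTITION (D-0054): none — RANK axis S3 × X5@2 stratum (β); types-the-object-of (stub 3b-C).
References: [cite: NeukirchANT1999, Ch. I §9 (9.1), (9.4)]; [cite: CasselsFrohlichANT1967, Ch. VII Prop. 1.2 (ii)].
-/

set_option autoImplicit false
-- the route's Theorems namespace repeats the summit name by design (D-0017 nested layout)
set_option linter.dupNamespace false

noncomputable section

open scoped Classical NumberField Pointwise

namespace Summit.BirchSwinnertonDyer.BirchSwinnertonDyer.Theorems.TwoAdicWbarStep

open Function NumberField IsDedekindDomain Field Rat.HeightOneSpectrum
  Literature.NumberTheory.GaloisRepresentations Literature.NumberTheory.EllipticCurves Literature.NumberTheory.Automorphic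

variable {K : Type} [Field K] [NumberField K]

/-! ## §1. A lift of `σ ∈ Aut(K/ℚ)` preserves the algebraic integers of `K̄` -/

/-- A ring automorphism `τ̃` of `K̄` lifting `σ ∈ Aut(K/ℚ)` maps `\bar ℤ_K` into itself (integral over `𝓞 K` ⇒ integral over `ℤ`
⇒ image integral over `ℤ` ⇒ integral over `𝓞 K`). [folklore] -/
theorem map_mem_absIntegers_of_isLiftOfAut {σ : K ≃ₐ[ℚ] K} {τ : AlgebraicClosure K ≃+* AlgebraicClosure K}
    (_hτ : IsLiftOfAut σ τ) {y : AlgebraicClosure K} (hy : y ∈ absIntegers (𝓞 K) K) :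
    τ y ∈ absIntegers (𝓞 K) K := by
  rw [absIntegers, mem_integralClosure_iff] at hy ⊢
  have h1 : IsIntegral ℤ y := isIntegral_trans (R := ℤ) (A := 𝓞 K) y hy
  have h2 : IsIntegral ℤ (τ y) := h1.map τ.toRingHom.toIntAlgHom
  exact h2.tower_top

/-! ## §2. Transport of a prime of `\bar ℤ_K` and of its decomposition group along `τ̃` -/

/-- **Transport of primes along a lift `τ̃` of `σ`** (Neukirch I (9.4), semilinear form).  For `𝔔` a prime of `\bar ℤ_K` above
the place `v` there is a prime `𝔔'` (namely `τ̃⁻¹ 𝔔`) above `σ⁻¹ • v` such that `τ̃⁻¹ x τ̃ ∈ D_{𝔔'}` for every `x ∈ D_𝔔`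
(`τ̃⁻¹ x τ̃ = IsLiftOfAut.conjGalCMH`). [cite: NeukirchANT1999, Ch. I §9 (9.4)] -/
theorem exists_primesAbove_smul_forall_conjGalCMH_mem {σ : K ≃ₐ[ℚ] K} {τ : AlgebraicClosure K ≃+* AlgebraicClosure K}
    (hτ : IsLiftOfAut σ τ) {v : HeightOneSpectrum (𝓞 K)} {𝔔 : Ideal (absIntegers (𝓞 K) K)} (h𝔔 : 𝔔 ∈ v.primesAbove) :
    ∃ 𝔔' ∈ (σ⁻¹ • v).primesAbove, ∀ x ∈ 𝔔.decompositionSubgroup (absoluteGaloisGroup K),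
      (hτ.conjGalCMH x : absoluteGaloisGroup K) ∈ 𝔔'.decompositionSubgroup (absoluteGaloisGroup K) := by
  haveI := h𝔔.1
  -- `τ̃` restricted to `\bar ℤ_K`
  let τA : absIntegers (𝓞 K) K →+* absIntegers (𝓞 K) K :=
    (τ.toRingHom.comp (absIntegers (𝓞 K) K).val.toRingHom).codRestrict (absIntegers (𝓞 K) K)
      fun y ↦ map_mem_absIntegers_of_isLiftOfAut hτ y.2
  have hτA : ∀ y : absIntegers (𝓞 K) K, (τA y : AlgebraicClosure K) = τ y := fun _ ↦ rfl
  refine ⟨𝔔.comap τA, ⟨Ideal.comap_isPrime τA 𝔔, ⟨?_⟩⟩, ?_⟩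
  · -- lies over `σ⁻¹ • v`
    ext y
    rw [HeightOneSpectrum.smul_asIdeal, Ideal.mem_inv_pointwise_smul_iff, Ideal.under_def, Ideal.mem_comap,
      Ideal.mem_comap]
    have hσy : τA (algebraMap (𝓞 K) (absIntegers (𝓞 K) K) y) = algebraMap (𝓞 K) (absIntegers (𝓞 K) K) (σ • y) := by
      apply Subtype.ext
      rw [hτA]
      change τ (algebraMap (𝓞 K) (AlgebraicClosure K) y) = algebraMap (𝓞 K) (AlgebraicClosure K) (σ • y)
      rw [IsScalarTower.algebraMap_apply (𝓞 K) K (AlgebraicClosure K), hτ,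
        IsScalarTower.algebraMap_apply (𝓞 K) K (AlgebraicClosure K)]
      rfl
    rw [hσy, ← Ideal.mem_comap, ← Ideal.under_def, ← h𝔔.2.over]
  · -- decomposition groups
    intro x hx
    rw [Ideal.mem_decompositionSubgroup_iff] at hx ⊢
    ext y
    rw [Ideal.mem_pointwise_smul_iff_inv_smul_mem, Ideal.mem_comap, Ideal.mem_comap]
    have key : τA ((hτ.conjGalCMH x : absoluteGaloisGroup K)⁻¹ • y) = x⁻¹ • τA y := by
      apply Subtype.ext
      rw [integralClosure.coe_smul, hτA, hτA, integralClosure.coe_smul, ← map_inv]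
      change τ ((show AlgebraicClosure K ≃ₐ[K] AlgebraicClosure K from hτ.conjGalHom x⁻¹) y) = _
      rw [IsLiftOfAut.conjGalHom_apply, RingEquiv.apply_symm_apply]
      rfl
    rw [key, ← Ideal.mem_pointwise_smul_iff_inv_smul_mem, hx]

/-! ## §3. The places of an imaginary quadratic field above a rational prime -/

/-- **The places of an imaginary quadratic `K` above a rational prime `p` are `w` and `σ • w`** (`σ ≠ 1` in `Aut(K/ℚ)`):
transitivity of `Gal(K/ℚ) = {1, σ}` on the places above `p`. [cite: CasselsFrohlichANT1967, Ch. VII Prop. 1.2 (ii)] -/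
theorem eq_or_eq_smul_of_natCast_mem (hK : IsImaginaryQuadratic K) {σ : K ≃ₐ[ℚ] K} (hσ : σ ≠ 1) {p : ℕ}
    (hp : p.Prime) {v w : HeightOneSpectrum (𝓞 K)} (hv : ((p : ℕ) : 𝓞 K) ∈ v.asIdeal) (hw : ((p : ℕ) : 𝓞 K) ∈ w.asIdeal) :
    v = w ∨ v = σ • w := by
  haveI : Algebra.IsQuadraticExtension ℚ K := ⟨hK.1⟩
  have hunder : w.under (𝓞 ℚ) = v.under (𝓞 ℚ) := by
    refine heightOneSpectrum_eq_of_natCast_mem hp ?_ ?_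
    · change (p : 𝓞 ℚ) ∈ w.asIdeal.under (𝓞 ℚ)
      rw [Ideal.under_def, Ideal.mem_comap, map_natCast]; exact hw
    · change (p : 𝓞 ℚ) ∈ v.asIdeal.under (𝓞 ℚ)
      rw [Ideal.under_def, Ideal.mem_comap, map_natCast]; exact hv
  obtain ⟨ρ, hρ⟩ := HeightOneSpectrum.exists_algEquiv_smul_eq (F := ℚ) (E := K) hunder
  have hcard : Nat.card (K ≃ₐ[ℚ] K) = 2 := by rw [IsGalois.card_aut_eq_finrank, hK.1]
  obtain ⟨y, -, hy⟩ := (Nat.card_eq_two_iff' (1 : K ≃ₐ[ℚ] K)).mp hcard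
  by_cases hρ1 : ρ = 1
  · left; rw [← hρ, hρ1, one_smul]
  · right
    rw [← hρ, hy ρ hρ1, ← hy σ hσ]

end Summit.BirchSwinnertonDyer.BirchSwinnertonDyer.Theorems.TwoAdicWbarStep

end
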